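import Summits.Ventures.PercRepro.RankLevelSetUpSeriesClassDual

/-! # RankLevelSetUpSeriesClassFour — (↑) AT LEVEL `4` ALONG A SERIES CLASS OF SIZE `≥ 3`: THE SERIES-TRIPLE CASE OF
(↑)₄ IS THE CLAIM ON ELEMENTARY QUOTIENT PAIRS (night-1 g38; dossier §50; on `RankLevelSetUpSeriesClassDual`)

For `M` coloop-free of nullity `4` with a series class `cl✶ {p}` of `≥ 3` elements and `10 ≤ #E`:
**`upAt_four_of_seriesClass`** — at `b ∉ cl✶ {p}`, `BiIndepUpAt M b 4` follows from `UpSeriesClaim M✶ p b`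
(`T_4 ≤ A_4 + q · g_3 ≤ Ā_5 + ḡ_3 + q · g_3 ≤ Ā_5 + q · ḡ_4 + C(q,2) · ḡ_3 ≤ V_5`, with `g_3 ≤ ḡ_4` from level `3`
of the deletion when `#E' ≥ 8`, complementation at `#E' = 7`, the class size `q ≥ 4` at `#E' = 6`, and both level-`3`
families empty at `#E' ≤ 5`); **`upAt_four_of_mem_seriesClass`** — at `b ∈ cl✶ {p}` no claim is needed (`W ↦ W ∖ P`
and `U ↦ U ∪ {p₁, p₂}` inject `T_4` into `V_5`). Together with `upAt_of_nullity_three` and `upAt_four_of_no_triple`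
(`RankLevelSetUpChain`), the residue `perElemAt_five_of_coloopFree_of_up_nullity` of (★★) at level `5` is reduced, on
the coloop-free matroids of nullity `4`, to `UpSeriesClaim`. Every declaration has a docstring; imports: the cell's
own modules and Mathlib only. Axioms: standard. -/

namespace PercRepro

open Set Matroid

variable {α : Type} (M : Matroid α) [M.Finite]
/-! ## The theorem -/

/-- **(↑) AT LEVEL `4` ALONG A SERIES CLASS OF SIZE `≥ 3`, FROM THE CLAIM ON THE QUOTIENT PAIR** (`M` coloop-free
of nullity `4`, `p ∈ E` with `#cl✶ {p} ≥ 3`, `b ∉ cl✶ {p}`, `10 ≤ #E`): `T_4 ≤ A_4 + q · g_3`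
(`through_four_le`), `A_4 ≤ Ā_5 + ḡ_3` (the claim), `g_3 ≤ ḡ_4` (level `3` of the deletion for `#E' ≥ 8`;
complementation at `#E' = 7`; at `#E' = 6` the class has `q ≥ 4` elements and `ḡ_3 = g_3`; at `#E' ≤ 5` both
vanish), and `Ā_5 + q · ḡ_4 + C(q,2) · ḡ_3 ≤ V_5` (`avoid_five_ge`). -/
theorem upAt_four_of_seriesClass (hcol : ∀ e, ¬ M.IsColoop e) (hν : M✶.eRank = 4) {p : α} (hp : p ∈ M.E)
    (hq : 3 ≤ (M✶.closure {p}).ncard) {b : α} (hb : b ∈ M.E) (hbP : b ∉ M✶.closure {p})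
    (hn : 10 ≤ M.E.ncard) (hclaim : UpSeriesClaim M✶ p b) : BiIndepUpAt M b 4 := by
  classical
  have hnl := dual_isNonloop_of_coloopFree' M hcol
  have hpE : p ∈ M✶.E := by rwa [Matroid.dual_ground]
  have hbE : b ∈ M✶.E := by rwa [Matroid.dual_ground]
  have hPE : M✶.closure {p} ⊆ M.E := M✶.closure_subset_ground _
  have hE'card : (M✶.E \ M✶.closure {p}).ncard + (M✶.closure {p}).ncard = M.E.ncard := by
    rw [Matroid.dual_ground, Set.ncard_sdiff hPE (M.ground_finite.subset hPE)]
    have := Set.ncard_le_ncard hPE M.ground_finite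
    omega
  unfold BiIndepUpAt
  rw [biIndep_eq_biSpan_dual, biIndep_eq_biSpan_dual]
  have hT := through_four_le M✶ hnl hν hpE (by omega) hbP
  have hV := avoid_five_ge M✶ hnl hpE hq hbP
  have hclaim' : (upFull M✶ p b 4).ncard ≤ (avoidFull M✶ p b 5).ncard + (avoidHat M✶ p b 3).ncard := hclaim
  -- the arithmetic `ḡ_3 + q · g_3 ≤ q · ḡ_4 + C(q,2) · ḡ_3`
  have hq1 : 1 ≤ (M✶.closure {p}).ncard.choose 2 := by
    have : 1 ≤ (2 : ℕ).choose 2 := by norm_num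
    exact this.trans (Nat.choose_le_choose 2 (by omega))
  have hkey : (avoidHat M✶ p b 3).ncard + (M✶.closure {p}).ncard * (throughHat M✶ p b 3).ncard ≤
      (M✶.closure {p}).ncard * (avoidHat M✶ p b 4).ncard +
        (M✶.closure {p}).ncard.choose 2 * (avoidHat M✶ p b 3).ncard := by
    rcases Nat.lt_or_ge (M✶.E \ M✶.closure {p}).ncard 8 with h8 | h8
    · rcases Nat.lt_or_ge (M✶.E \ M✶.closure {p}).ncard 7 with h7 | h7
      · rcases Nat.lt_or_ge (M✶.E \ M✶.closure {p}).ncard 6 with h6 | h6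
        · -- `#E' ≤ 5`: both level-`3` families are empty
          have hg : (throughHat M✶ p b 3).ncard = 0 := by
            rw [Set.ncard_eq_zero (throughHat_finite M✶ p b 3)]
            by_contra hne
            obtain ⟨U, hU⟩ := Set.nonempty_iff_ne_empty.mpr hne
            have := six_le_of_mem_hat_three M✶ hν (p := p) (b := b) (Or.inl hU)
            omega
          have hg' : (avoidHat M✶ p b 3).ncard = 0 := by
            rw [Set.ncard_eq_zero (avoidHat_finite M✶ p b 3)]
            by_contra hne
            obtain ⟨U, hU⟩ := Set.nonempty_iff_ne_empty.mpr hne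
            have := six_le_of_mem_hat_three M✶ hν (p := p) (b := b) (Or.inr hU)
            omega
          rw [hg, hg']; omega
        · -- `#E' = 6`: `ḡ_3 = g_3` and `q ≥ 4`, `C(q,2) ≥ q + 1`
          have h6' : (M✶.E \ M✶.closure {p}).ncard = 6 := by omega
          have hc : (avoidHat M✶ p b 3).ncard = (throughHat M✶ p b 3).ncard := by
            rw [avoidHat_ncard_eq_throughHat_compl M✶ hbE hbP (by omega), h6']
          have hq4 : 4 ≤ (M✶.closure {p}).ncard := by omega
          have hch : (M✶.closure {p}).ncard + 1 ≤ (M✶.closure {p}).ncard.choose 2 := by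
            have h2 : 2 * (M✶.closure {p}).ncard.choose 2 =
                (M✶.closure {p}).ncard * ((M✶.closure {p}).ncard - 1) := by
              rw [Nat.choose_two_right]
              exact Nat.two_mul_div_two_of_even (Nat.even_mul_pred_self _)
            have h5 : 3 ≤ (M✶.closure {p}).ncard - 1 := by omega
            have h6 : (M✶.closure {p}).ncard * 3 ≤ (M✶.closure {p}).ncard * ((M✶.closure {p}).ncard - 1) :=
              Nat.mul_le_mul_left _ h5
            omega
          rw [hc]
          have h4 : (M✶.closure {p}).ncard * (throughHat M✶ p b 3).ncard + (throughHat M✶ p b 3).ncard ≤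
              (M✶.closure {p}).ncard.choose 2 * (throughHat M✶ p b 3).ncard := by
            have := Nat.mul_le_mul_right (throughHat M✶ p b 3).ncard hch
            rwa [Nat.add_mul, Nat.one_mul] at this
          omega
      · -- `#E' = 7`: `ḡ_4 = g_3`
        have h7' : (M✶.E \ M✶.closure {p}).ncard = 7 := by omega
        have hc : (avoidHat M✶ p b 4).ncard = (throughHat M✶ p b 3).ncard := by
          rw [avoidHat_ncard_eq_throughHat_compl M✶ hbE hbP (by omega), h7']
        rw [hc]
        have h2 := Nat.mul_le_mul_right (avoidHat M✶ p b 3).ncard hq1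
        omega
    · -- `#E' ≥ 8`: level `3` of the deletion
      have hg := throughHat_three_le_avoidHat_four M hcol hν hp hb hbP h8
      have h1 := Nat.mul_le_mul_left (M✶.closure {p}).ncard hg
      have h2 := Nat.mul_le_mul_right (avoidHat M✶ p b 3).ncard hq1
      omega
  calc {W ∈ biSpan M✶ 4 | b ∈ W}.ncard
      ≤ (upFull M✶ p b 4).ncard + (M✶.closure {p}).ncard * (throughHat M✶ p b 3).ncard := hT
    _ ≤ (avoidFull M✶ p b 5).ncard + (avoidHat M✶ p b 3).ncard +
          (M✶.closure {p}).ncard * (throughHat M✶ p b 3).ncard := by omega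
    _ ≤ (avoidFull M✶ p b 5).ncard + (M✶.closure {p}).ncard * (avoidHat M✶ p b 4).ncard +
          (M✶.closure {p}).ncard.choose 2 * (avoidHat M✶ p b 3).ncard := by omega
    _ ≤ {Z ∈ biSpan M✶ 5 | b ∉ Z}.ncard := hV

/-- **(↑) AT LEVEL `4` AT AN ELEMENT OF A SERIES CLASS OF SIZE `≥ 3`** (`M` coloop-free of nullity `4`, `b ∈ cl✶ {p}`,
`#cl✶ {p} ≥ 3`): a bi-independent `4`-set through `b` meets the class exactly in `b`, so `W ↦ W ∖ cl✶ {p}` injects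
`T_4` into the bi-spanning `3`-sets `U` of the contraction, and `U ↦ U ∪ {p₁, p₂}` (two other elements of the class)
injects those into the bi-independent `5`-sets avoiding `b`. No claim is needed. -/
theorem upAt_four_of_mem_seriesClass (hcol : ∀ e, ¬ M.IsColoop e) (hν : M✶.eRank = 4) {p : α} (hp : p ∈ M.E)
    (hq : 3 ≤ (M✶.closure {p}).ncard) {b : α} (hbP : b ∈ M✶.closure {p}) : BiIndepUpAt M b 4 := by
  classical
  have hnl := dual_isNonloop_of_coloopFree' M hcol
  have hpE : p ∈ M✶.E := by rwa [Matroid.dual_ground]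
  have hpnl : M✶.IsNonloop p := hnl p hpE
  have hPE : M✶.closure {p} ⊆ M✶.E := M✶.closure_subset_ground _
  have hPfin : (M✶.closure {p}).Finite := M✶.ground_finite.subset hPE
  have hbE : b ∈ M✶.E := hPE hbP
  -- two further elements of the class
  obtain ⟨p₁, hp₁, p₂, hp₂, hp₁₂⟩ : ∃ p₁ ∈ M✶.closure {p} \ {b}, ∃ p₂ ∈ M✶.closure {p} \ {b}, p₁ ≠ p₂ := by
    rw [← Set.one_lt_ncard (hPfin.subset Set.sdiff_subset), Set.ncard_sdiff_singleton_of_mem hbP]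
    omega
  have hp₁b : p₁ ≠ b := fun h => hp₁.2 (by rw [Set.mem_singleton_iff]; exact h)
  have hp₂b : p₂ ≠ b := fun h => hp₂.2 (by rw [Set.mem_singleton_iff]; exact h)
  -- the bi-spanning `3`-sets of the contraction (no condition on `b`)
  let G : Set (Set α) := {U | U ⊆ M✶.E \ M✶.closure {p} ∧ U.ncard = 3 ∧ M✶.Spanning (insert p U) ∧
    M✶.Spanning (insert p ((M✶.E \ M✶.closure {p}) \ U))}
  have hGfin : G.Finite := (M✶.ground_finite.subset Set.sdiff_subset).finite_subsets.subset (fun _ h => h.1)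
  unfold BiIndepUpAt
  rw [biIndep_eq_biSpan_dual, biIndep_eq_biSpan_dual]
  have hVfin : {Z ∈ biSpan M✶ 5 | b ∉ Z}.Finite :=
    M✶.ground_finite.finite_subsets.subset (fun _ h => h.1.1)
  -- first injection `W ↦ W ∖ cl {p}`
  have h1 : {W ∈ biSpan M✶ 4 | b ∈ W}.ncard ≤ G.ncard := by
    refine Set.ncard_le_ncard_of_injOn (fun W => W \ M✶.closure {p}) ?_ ?_ hGfin
    · rintro W ⟨⟨hWE, hW4, hWs, hWc⟩, hbW⟩
      have hWfin : W.Finite := M✶.ground_finite.subset hWE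
      have hsing : W ∩ M✶.closure {p} = {b} := by
        ext y
        constructor
        · intro hy
          by_contra hyb
          exact not_two_parallel_of_spanning_four hnl hν hWs hW4 (p := p) hy.1 hbW
            (fun h => hyb (by rw [Set.mem_singleton_iff]; exact h)) hy.2 hbP
        · intro hy; rw [Set.mem_singleton_iff] at hy; rw [hy]; exact ⟨hbW, hbP⟩
      have hcard1 : (W ∩ M✶.closure {p}).ncard = 1 := by rw [hsing, Set.ncard_singleton]
      refine ⟨fun y hy => ⟨hWE hy.1, hy.2⟩, ?_, ?_, ?_⟩
      · have h := Set.ncard_inter_add_ncard_sdiff_eq_ncard W (M✶.closure {p}) hWfin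
        rw [hcard1, hW4] at h
        omega
      · have hW' : W = (W \ M✶.closure {p}) ∪ (W ∩ M✶.closure {p}) := by rw [Set.sdiff_union_inter]
        rw [hW'] at hWs
        exact (spanning_union_iff_insert M✶ hnl hpnl Set.inter_subset_right ⟨b, hbW, hbP⟩
          (Set.sdiff_subset.trans hWE)).mp hWs
      · have hcompl : M✶.E \ W = ((M✶.E \ M✶.closure {p}) \ (W \ M✶.closure {p})) ∪ (M✶.closure {p} \ W) := by
          ext y
          simp only [Set.mem_sdiff, Set.mem_union, not_and, not_not]
          constructor
          · rintro ⟨hyE, hyW⟩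
            by_cases hyP : y ∈ M✶.closure {p}
            · exact Or.inr ⟨hyP, hyW⟩
            · exact Or.inl ⟨⟨hyE, hyP⟩, fun h => absurd h hyW⟩
          · rintro (⟨⟨hyE, hyP⟩, h⟩ | ⟨hyP, hyW⟩)
            · exact ⟨hyE, fun hyW => hyP (h hyW)⟩
            · exact ⟨hPE hyP, hyW⟩
        rw [hcompl] at hWc
        have hne : (M✶.closure {p} \ W).Nonempty := by
          refine ⟨p₁, hp₁.1, fun h => ?_⟩
          have : p₁ ∈ W ∩ M✶.closure {p} := ⟨h, hp₁.1⟩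
          rw [hsing, Set.mem_singleton_iff] at this
          exact hp₁b this
        exact (spanning_union_iff_insert M✶ hnl hpnl Set.sdiff_subset hne
          (Set.sdiff_subset.trans Set.sdiff_subset)).mp hWc
    · rintro W ⟨⟨hWE, hW4, hWs, -⟩, hbW⟩ W' ⟨⟨hW'E, hW'4, hW's, -⟩, hbW'⟩ heq
      simp only at heq
      have hsing : W ∩ M✶.closure {p} = {b} := by
        ext y
        constructor
        · intro hy
          by_contra hyb
          exact not_two_parallel_of_spanning_four hnl hν hWs hW4 (p := p) hy.1 hbW
            (fun h => hyb (by rw [Set.mem_singleton_iff]; exact h)) hy.2 hbP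
        · intro hy; rw [Set.mem_singleton_iff] at hy; rw [hy]; exact ⟨hbW, hbP⟩
      have hsing' : W' ∩ M✶.closure {p} = {b} := by
        ext y
        constructor
        · intro hy
          by_contra hyb
          exact not_two_parallel_of_spanning_four hnl hν hW's hW'4 (p := p) hy.1 hbW'
            (fun h => hyb (by rw [Set.mem_singleton_iff]; exact h)) hy.2 hbP
        · intro hy; rw [Set.mem_singleton_iff] at hy; rw [hy]; exact ⟨hbW', hbP⟩
      rw [← Set.sdiff_union_inter W (M✶.closure {p}), ← Set.sdiff_union_inter W' (M✶.closure {p}), heq,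
        hsing, hsing']
  -- second injection `U ↦ U ∪ {p₁, p₂}`
  have h2 : G.ncard ≤ {Z ∈ biSpan M✶ 5 | b ∉ Z}.ncard := by
    refine Set.ncard_le_ncard_of_injOn (fun U => U ∪ {p₁, p₂}) ?_ ?_ hVfin
    · rintro U ⟨hUE, hU3, hUs, hUc⟩
      have hUfin : U.Finite := M✶.ground_finite.subset (hUE.trans Set.sdiff_subset)
      have hSP : ({p₁, p₂} : Set α) ⊆ M✶.closure {p} := by
        intro x hx
        rcases hx with rfl | hx
        · exact hp₁.1
        · rw [Set.mem_singleton_iff] at hx; rw [hx]; exact hp₂.1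
      have hdj : Disjoint U {p₁, p₂} := by
        rw [Set.disjoint_left]
        intro x hxU hxS
        exact (hUE hxU).2 (hSP hxS)
      have hPSne : (M✶.closure {p} \ {p₁, p₂}).Nonempty := by
        refine ⟨b, hbP, fun h => ?_⟩
        rcases h with h | h
        · exact hp₁b h.symm
        · rw [Set.mem_singleton_iff] at h; exact hp₂b h.symm
      refine ⟨⟨Set.union_subset (hUE.trans Set.sdiff_subset) (hSP.trans hPE), ?_, ?_, ?_⟩, ?_⟩
      · rw [Set.ncard_union_eq hdj hUfin (Set.toFinite _), hU3, Set.ncard_pair hp₁₂]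
      · exact (spanning_union_iff_insert M✶ hnl hpnl hSP ⟨p₁, by simp⟩ (hUE.trans Set.sdiff_subset)).mpr hUs
      · rw [compl_union_eq M✶ hPE hUE hSP]
        exact (spanning_union_iff_insert M✶ hnl hpnl Set.sdiff_subset hPSne
          (Set.sdiff_subset.trans Set.sdiff_subset)).mpr hUc
      · rintro (hbU | hbS)
        · exact (hUE hbU).2 hbP
        · rcases hbS with h | h
          · exact hp₁b h.symm
          · rw [Set.mem_singleton_iff] at h; exact hp₂b h.symm
    · rintro U ⟨hUE, -⟩ U' ⟨hU'E, -⟩ heq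
      simp only at heq
      have hSP : ({p₁, p₂} : Set α) ⊆ M✶.closure {p} := by
        intro x hx
        rcases hx with rfl | hx
        · exact hp₁.1
        · rw [Set.mem_singleton_iff] at hx; rw [hx]; exact hp₂.1
      have hU : U = (U ∪ {p₁, p₂}) \ M✶.closure {p} := by
        ext x; simp only [Set.mem_sdiff, Set.mem_union]
        constructor
        · intro hx; exact ⟨Or.inl hx, (hUE hx).2⟩
        · rintro ⟨hx | hx, hxP⟩
          · exact hx
          · exact absurd (hSP hx) hxP
      have hU' : U' = (U' ∪ {p₁, p₂}) \ M✶.closure {p} := by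
        ext x; simp only [Set.mem_sdiff, Set.mem_union]
        constructor
        · intro hx; exact ⟨Or.inl hx, (hU'E hx).2⟩
        · rintro ⟨hx | hx, hxP⟩
          · exact hx
          · exact absurd (hSP hx) hxP
      rw [hU, hU', heq]
  exact h1.trans h2

end PercRepro
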